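import Summits.Ventures.PercRepro2.CaseOneRootsAndOQ

/-!
# The Q-threshold form `(ii-Q)` for the roots-and-`b` class (blind cell PercRepro2, p1 g28;
S5 §2.3: the `(ii-Q)` entry of the row «roots + one edge to `b`»)

`zSplitII_of_rootsAndB` (CaseOneRootsAndMark) gives `(ii)` at the PD pair for `a₃` adjacent to the
roots (any multiplicities) and to `b`; its D-world induction carries the PD pair because the PD masses
scale uniformly under the pinning of a root edge. The Q pair `(P(Q, o ∈ U), P(Q))` does not scale, so
here the pair is FIXED and the base case — `a₃` a leaf at `b` in the support — needs the odds condition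
`c₁ · P′(Q, a₃ ∈ C₁, o ∈ C₂) ≤ c₀ · P′(Q, a₃ ∈ C₁)` for the PINNED vector `p′` (in the leaf state the
`b ∈ C₂`-masses on `{a₃ ∈ C₁} ∩ Q` vanish and `iiExprD = P(D, b ∈ C₂) · (c₀ P(Q, a₃ ∈ C₁) −
c₁ P(Q, a₃ ∈ C₁, o ∈ C₂))`, **`iiExprD_nonneg_of_leaf_supp_b`**). The point of the module is that this
odds condition is TRANSPORTED down the pinning chain:

* an `a₁a₃`-edge `e₁` (weight `r`, `p₀ = p[e₁ ↦ 0]`): `P(Q, a₃ ∈ C₁) = r P₀(D) + (1 − r) P₀(Q, a₃ ∈ C₁)`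
  and `P(Q, a₃ ∈ C₁, o ∈ C₂) = r P₀(D, o ∈ C₂) + (1 − r) P₀(Q, a₃ ∈ C₁, o ∈ C₂)` (`prob_A_inter_Dw_pin`),
  while BHK 1.4 with the avoided set `{a₁, a₃}` gives `P₀(D) P₀(Q, a₃ ∈ C₁, o ∈ C₂) ≤ P₀(D, o ∈ C₂)
  P₀(Q, a₃ ∈ C₁)` — the odds `P(o ∈ C₂ ∣ Q, a₃ ∈ C₁)` can only DROP under the pinning, so the odds
  condition at `p` implies it at `p₀` (**`odds_of_a1_edge`**);
* an `a₂a₃`-edge: both masses scale by `1 − p(e₂)` (**`odds_of_a2_edge`**; at weight `1` the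
  D-world `(ii)` of `p` is `0` by identity (E′) and nothing is needed).

With identities (E) and (E′) (`iiExprD_a1_edge`, `iiExprD_a2_edge`) and `covDw_nonneg` the D-world
`(ii)` of the class is nonnegative at EVERY pair with `c₁ ≥ 0` satisfying the odds condition at `p`
(**`iiExprD_nonneg_of_rootsAnd_odds`**, an induction with an abstract leaf base, and
**`iiExprD_nonneg_of_rootsAndB`**); at the Q pair the condition is `odds_q` itself, and the one-line
lemma `iiExprT_nonneg_of_dworld` gives **`zSplitIIQ_of_rootsAndB`**: `(ii-Q)` for `a₃` adjacent to the
roots (any multiplicities) and to `b`, every finite graph, every weight vector. The transport lemmas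
hold for EVERY `a₃` (no class hypothesis). Own code; standard axioms.
-/

namespace Summit.Ventures.PercRepro2

namespace CaseOne

/-! ## The leaf-at-`b` base at a general pair -/

section Base
variable {V : Type*} {E : Type*} [Fintype E] [DecidableEq E] [Fintype V] [DecidableEq V]
  {R : Type*} [Field R] [LinearOrder R] [IsStrictOrderedRing R]
variable {ends : E → Sym2 V} {a₁ a₂ a₃ : V}

omit [Fintype V] [DecidableEq V] in
/-- **The D-world `(ii)` of a leaf at `b` in the support** is nonnegative at every pair with
`c₁ · P(Q, a₃ ∈ C₁, o ∈ C₂) ≤ c₀ · P(Q, a₃ ∈ C₁)`: the `b ∈ C₂`-masses on `{a₃ ∈ C₁} ∩ Q` vanish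
(`a₃ ∈ C₁` forces `b ∈ C₁`), leaving `P(D, b ∈ C₂) · (c₀ P(Q, a₃ ∈ C₁) − c₁ P(Q, a₃ ∈ C₁, o ∈ C₂))`. -/
theorem iiExprD_nonneg_of_leaf_supp_b {p : E → R} (hp : IsProbVec p) {b : V} {e₀ : E}
    (hl : IsLeafSupp p ends b a₃ e₀) (h1 : a₁ ≠ a₃) (o : V) (c₀ c₁ : R)
    (hodds : c₁ * prob p (connEvent ends a₁ a₃ ∩ connEvent ends a₂ o ∩ (connEvent ends a₁ a₂)ᶜ) ≤
      c₀ * prob p (connEvent ends a₁ a₃ ∩ (connEvent ends a₁ a₂)ᶜ)) :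
    0 ≤ iiExprD p ends o a₁ a₂ a₃ b c₀ c₁ := by
  rw [iiExprD_eq]
  rw [prob_AO_eq_zero_of_leaf_supp_o hl h1 (X := connEvent ends a₂ b ∩ connEvent ends a₁ a₃ ∩
      connEvent ends a₂ o ∩ (connEvent ends a₁ a₂)ᶜ) (fun _ h => ⟨⟨h.1.1.2, h.1.1.1⟩, h.2⟩),
    prob_AO_eq_zero_of_leaf_supp_o hl h1 (X := connEvent ends a₂ b ∩ connEvent ends a₁ a₃ ∩
      (connEvent ends a₁ a₂)ᶜ) (fun _ h => ⟨⟨h.1.2, h.1.1⟩, h.2⟩)]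
  have hB := prob_nonneg hp (connEvent ends a₂ b ∩ Dw ends a₁ a₂ a₃)
  nlinarith [hodds, hB]

end Base

/-! ## The odds condition is transported down the pinning chain (every `a₃`) -/

section Transport
variable {V : Type*} {E : Type*} [Fintype E] [DecidableEq E] [Fintype V] [DecidableEq V]
  {R : Type*} [Field R] [LinearOrder R] [IsStrictOrderedRing R]
variable {ends : E → Sym2 V} {a₁ a₂ a₃ : V}

omit [Fintype E] [DecidableEq E] [Fintype V] [DecidableEq V] in
/-- `{a₃ ∈ C₁} ∩ {o ∈ C₂} ∩ Q` in its D-form with `{o ∈ C₂}` in front. -/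
lemma OA_inter_Dw_eq (ends : E → Sym2 V) (o a₁ a₂ a₃ : V) :
    connEvent ends a₂ o ∩ connEvent ends a₁ a₃ ∩ Dw ends a₁ a₂ a₃ =
      connEvent ends a₁ a₃ ∩ connEvent ends a₂ o ∩ (connEvent ends a₁ a₂)ᶜ := by
  rw [← AO_inter_Dw]
  ext ω; simp only [Set.mem_inter_iff]; tauto

omit [Fintype E] [DecidableEq E] [Fintype V] [DecidableEq V] in
/-- The same with `Q` in place of `D`. -/
lemma OA_inter_Q_eq (ends : E → Sym2 V) (o a₁ a₂ a₃ : V) :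
    connEvent ends a₂ o ∩ connEvent ends a₁ a₃ ∩ (connEvent ends a₁ a₂)ᶜ =
      connEvent ends a₁ a₃ ∩ connEvent ends a₂ o ∩ (connEvent ends a₁ a₂)ᶜ := by
  ext ω; simp only [Set.mem_inter_iff]; tauto

/-- **BHK 1.4 with the avoided set `{a₁, a₃}` for the pair `{o ∈ C₂}`, `{a₃ ∈ C₁}`**:
`P(Q, a₃ ∈ C₁, o ∈ C₂) · P(D) ≤ P(D, o ∈ C₂) · P(Q, a₃ ∈ C₁)` — the odds `P(o ∈ C₂ ∣ Q, a₃ ∈ C₁)` are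
at most `P(o ∈ C₂ ∣ D)`. -/
theorem bhk_odds_Dw (p : E → R) (hp : IsProbVec p) (ends : E → Sym2 V) (o a₁ a₂ a₃ : V) :
    prob p (connEvent ends a₁ a₃ ∩ connEvent ends a₂ o ∩ (connEvent ends a₁ a₂)ᶜ) *
        prob p (Dw ends a₁ a₂ a₃) ≤
      prob p (connEvent ends a₂ o ∩ Dw ends a₁ a₂ a₃) *
        prob p (connEvent ends a₁ a₃ ∩ (connEvent ends a₁ a₂)ᶜ) := by
  have h := bhk_cross_cluster_avoid p hp ends a₂ a₁ (X := ({a₁, a₃} : Finset V)) (by simp)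
    (isUpperSet_mem_setOf o) (isUpperSet_mem_setOf a₃)
  rw [← connEvent_eq_clusterInEvent ends a₂ o, ← connEvent_eq_clusterInEvent ends a₁ a₃,
    ← Dw_eq_avoidAll, OA_inter_Dw_eq, A_inter_Dw] at h
  exact h

/-- **The odds condition is transported along an `a₁a₃`-edge**: if
`c₁ · P(Q, a₃ ∈ C₁, o ∈ C₂) ≤ c₀ · P(Q, a₃ ∈ C₁)` at `p` (with `c₁ ≥ 0`), then the same holds at
`p[e₁ ↦ 0]`. -/
theorem odds_of_a1_edge (p : E → R) (hp : IsProbVec p) {e₁ : E} (he : ends e₁ = s(a₁, a₃)) (o : V)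
    (c₀ c₁ : R) (hc₁ : 0 ≤ c₁)
    (hodds : c₁ * prob p (connEvent ends a₁ a₃ ∩ connEvent ends a₂ o ∩ (connEvent ends a₁ a₂)ᶜ) ≤
      c₀ * prob p (connEvent ends a₁ a₃ ∩ (connEvent ends a₁ a₂)ᶜ)) :
    c₁ * prob (Function.update p e₁ 0)
        (connEvent ends a₁ a₃ ∩ connEvent ends a₂ o ∩ (connEvent ends a₁ a₂)ᶜ) ≤
      c₀ * prob (Function.update p e₁ 0) (connEvent ends a₁ a₃ ∩ (connEvent ends a₁ a₂)ᶜ) := by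
  have hp0 : IsProbVec (Function.update p e₁ 0) := hp.update e₁ le_rfl zero_le_one
  -- the two masses under the pinning
  have hX := prob_A_inter_Dw_pin p he Set.univ
    (univ_event_update (ends := ends) (a₁ := a₁) (a₂ := a₂) (a₃ := a₃) (e₁ := e₁))
  rw [Set.univ_inter, Set.univ_inter, A_inter_Dw] at hX
  have hY := prob_A_inter_Dw_pin p he (connEvent ends a₂ o) (a2_event_update (a₂ := a₂) he o)
  rw [OA_inter_Dw_eq] at hY
  -- BHK at the pinned vector
  have hbhk := bhk_odds_Dw (Function.update p e₁ 0) hp0 ends o a₁ a₂ a₃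
  -- the masses at the pinned vector
  set X₀ := prob (Function.update p e₁ 0) (connEvent ends a₁ a₃ ∩ (connEvent ends a₁ a₂)ᶜ) with hX₀
  set Y₀ := prob (Function.update p e₁ 0)
    (connEvent ends a₁ a₃ ∩ connEvent ends a₂ o ∩ (connEvent ends a₁ a₂)ᶜ) with hY₀
  set M₁ := prob (Function.update p e₁ 0) (Dw ends a₁ a₂ a₃) with hM₁
  set N₁ := prob (Function.update p e₁ 0) (connEvent ends a₂ o ∩ Dw ends a₁ a₂ a₃) with hN₁
  have hYX : Y₀ ≤ X₀ := prob_mono hp0 (fun ω h => ⟨h.1.1, h.2⟩)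
  have hY0 : 0 ≤ Y₀ := prob_nonneg hp0 _
  have hM0 : 0 ≤ M₁ := prob_nonneg hp0 _
  have hN0 : 0 ≤ N₁ := prob_nonneg hp0 _
  have hr0 : 0 ≤ p e₁ := hp.nonneg e₁
  have hr1 : 0 ≤ 1 - p e₁ := sub_nonneg.2 (hp.le_one e₁)
  rw [hX, hY] at hodds
  -- `hodds : c₁ (r N₁ + (1 − r) Y₀) ≤ c₀ (r M₁ + (1 − r) X₀)`, `hbhk : Y₀ M₁ ≤ N₁ X₀`
  have hXM : X₀ ≤ M₁ := by
    rw [hX₀, hM₁, ← A_inter_Dw]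
    exact prob_mono hp0 Set.inter_subset_right
  by_contra hcon
  rw [not_le] at hcon
  -- `X₀ > 0` (else `Y₀ = 0` and `hcon` reads `c₀ · 0 < c₁ · 0`), hence `M₁ > 0`
  have hX0 : 0 ≤ X₀ := prob_nonneg hp0 _
  have hXpos : 0 < X₀ := by
    rcases hX0.lt_or_eq with h | h
    · exact h
    · exfalso
      have hY00 : Y₀ = 0 := le_antisymm (h ▸ hYX) hY0
      rw [← h, hY00] at hcon
      simp at hcon
  have hMpos : 0 < M₁ := lt_of_lt_of_le hXpos hXM
  -- `c₀ M₁ ≤ c₁ N₁`: `c₀ X₀ M₁ ≤ c₁ Y₀ M₁ ≤ c₁ N₁ X₀`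
  have h1 : c₀ * M₁ ≤ c₁ * N₁ := by
    have h2 : c₀ * M₁ * X₀ ≤ c₁ * N₁ * X₀ := by
      nlinarith [mul_le_mul_of_nonneg_left hbhk hc₁, mul_le_mul_of_nonneg_right hcon.le hM0]
    exact le_of_mul_le_mul_right h2 hXpos
  -- `(1 − r) (c₁ Y₀ − c₀ X₀) ≤ 0`
  have key : (1 - p e₁) * (c₁ * Y₀ - c₀ * X₀) ≤ 0 := by
    nlinarith [hodds, mul_le_mul_of_nonneg_left h1 hr0]
  rcases (hp.le_one e₁).lt_or_eq with hr | hr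
  · have h3 : (1 - p e₁) * (c₁ * Y₀ - c₀ * X₀) ≤ (1 - p e₁) * 0 := by linarith [key]
    have := le_of_mul_le_mul_left h3 (sub_pos.2 hr)
    linarith
  · rw [hr] at hodds
    simp only [one_mul, sub_self, zero_mul, add_zero] at hodds
    have e : c₀ * M₁ = c₁ * N₁ := le_antisymm h1 hodds
    have e2 : c₀ * M₁ * X₀ = c₁ * N₁ * X₀ := by rw [e]
    nlinarith [mul_lt_mul_of_pos_right hcon hMpos, mul_le_mul_of_nonneg_left hbhk hc₁, e2]

omit [Fintype V] [DecidableEq V] in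
/-- **The odds condition is transported along an `a₂a₃`-edge of weight `< 1`**: both masses scale by
`1 − p(e₂)`. -/
theorem odds_of_a2_edge (p : E → R) {e₂ : E} (he : ends e₂ = s(a₂, a₃)) (o : V) (c₀ c₁ : R)
    (hlt : p e₂ < 1)
    (hodds : c₁ * prob p (connEvent ends a₁ a₃ ∩ connEvent ends a₂ o ∩ (connEvent ends a₁ a₂)ᶜ) ≤
      c₀ * prob p (connEvent ends a₁ a₃ ∩ (connEvent ends a₁ a₂)ᶜ)) :
    c₁ * prob (Function.update p e₂ 0)
        (connEvent ends a₁ a₃ ∩ connEvent ends a₂ o ∩ (connEvent ends a₁ a₂)ᶜ) ≤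
      c₀ * prob (Function.update p e₂ 0) (connEvent ends a₁ a₃ ∩ (connEvent ends a₁ a₂)ᶜ) := by
  rw [← A_inter_Dw, ← AO_inter_Dw] at hodds ⊢
  rw [prob_a2_edge_of_subset_Dw p he (Y := connEvent ends a₁ a₃ ∩ Dw ends a₁ a₂ a₃) (fun _ h => h.2),
    prob_a2_edge_of_subset_Dw p he (Y := connEvent ends a₁ a₃ ∩ connEvent ends a₂ o ∩
      Dw ends a₁ a₂ a₃) (fun _ h => h.2)] at hodds
  have hpos : 0 < 1 - p e₂ := sub_pos.2 hlt
  have h : (1 - p e₂) * (c₁ * prob (Function.update p e₂ 0)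
      (connEvent ends a₁ a₃ ∩ connEvent ends a₂ o ∩ Dw ends a₁ a₂ a₃)) ≤
      (1 - p e₂) * (c₀ * prob (Function.update p e₂ 0)
        (connEvent ends a₁ a₃ ∩ Dw ends a₁ a₂ a₃)) := by
    linarith [hodds]
  exact le_of_mul_le_mul_left h hpos

end Transport

/-! ## The induction at a fixed pair, with an abstract leaf base -/

section Induction
variable {V : Type*} {E : Type*} [Fintype E] [DecidableEq E] [Fintype V] [DecidableEq V]
  {R : Type*} [Field R] [LinearOrder R] [IsStrictOrderedRing R]
variable {ends : E → Sym2 V} {a₁ a₂ a₃ : V} {e₀ : E}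

/-- **Induction over the root edges at `a₃` at a FIXED threshold pair**: if every edge at `a₃` other
than `e₀` is a root edge, the pair `(c₀, c₁)` has `c₁ ≥ 0` and satisfies the odds condition
`c₁ · P(Q, a₃ ∈ C₁, o ∈ C₂) ≤ c₀ · P(Q, a₃ ∈ C₁)` at `p`, and the D-world `(ii)` at `(c₀, c₁)` holds for
every admissible weight vector with all those root edges null that satisfies the odds condition, then
`0 ≤ iiExprD p c₀ c₁`. -/
theorem iiExprD_nonneg_of_rootsAnd_odds (p : E → R) (hp : IsProbVec p)
    (hroot : ∀ e, a₃ ∈ ends e → e ≠ e₀ → ends e = s(a₁, a₃) ∨ ends e = s(a₂, a₃)) {o b : V}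
    (c₀ c₁ : R) (hc₁ : 0 ≤ c₁)
    (hodds : c₁ * prob p (connEvent ends a₁ a₃ ∩ connEvent ends a₂ o ∩ (connEvent ends a₁ a₂)ᶜ) ≤
      c₀ * prob p (connEvent ends a₁ a₃ ∩ (connEvent ends a₁ a₂)ᶜ))
    (base : ∀ p' : E → R, IsProbVec p' → (∀ e, a₃ ∈ ends e → e ≠ e₀ → p' e = 0) →
      c₁ * prob p' (connEvent ends a₁ a₃ ∩ connEvent ends a₂ o ∩ (connEvent ends a₁ a₂)ᶜ) ≤
        c₀ * prob p' (connEvent ends a₁ a₃ ∩ (connEvent ends a₁ a₂)ᶜ) →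
      0 ≤ iiExprD p' ends o a₁ a₂ a₃ b c₀ c₁) :
    0 ≤ iiExprD p ends o a₁ a₂ a₃ b c₀ c₁ := by
  generalize hn : (liveRoot p ends a₃ e₀).card = n
  induction n using Nat.strong_induction_on generalizing p with
  | _ n ih =>
    by_cases h0 : liveRoot p ends a₃ e₀ = ∅
    · refine base p hp (fun e he hne => ?_) hodds
      by_contra hc
      have : e ∈ liveRoot p ends a₃ e₀ := by simp [liveRoot, he, hne, hc]
      rw [h0] at this
      exact absurd this (Finset.notMem_empty e)
    · obtain ⟨e, he⟩ := Finset.nonempty_iff_ne_empty.mpr h0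
      have he' : a₃ ∈ ends e ∧ e ≠ e₀ := by
        have := he
        simp only [liveRoot, Finset.mem_filter, Finset.mem_univ, true_and] at this
        exact ⟨this.1, this.2.1⟩
      have hlt : ((liveRoot p ends a₃ e₀).erase e).card < n := by
        rw [← hn]; exact Finset.card_erase_lt_of_mem he
      have hp0 : IsProbVec (Function.update p e 0) := hp.update e le_rfl zero_le_one
      have hpe : 0 ≤ p e := hp.nonneg e
      have hpe' : 0 ≤ 1 - p e := sub_nonneg.2 (hp.le_one e)
      rcases hroot e he'.1 he'.2 with h | h
      · have hodds0 := odds_of_a1_edge p hp h o c₀ c₁ hc₁ hodds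
        have hrec := ih _ hlt (Function.update p e 0) hp0 hodds0 (by rw [liveRoot_update])
        rw [iiExprD_a1_edge p h o b c₀ c₁]
        have hcov := covDw_nonneg (Function.update p e 0) hp0 ends o a₁ a₂ a₃ b
        have t1 := mul_nonneg (mul_nonneg hpe hc₁) hcov
        have t2 := mul_nonneg hpe' hrec
        linarith [t1, t2]
      · rw [iiExprD_a2_edge p h o b c₀ c₁]
        rcases (hp.le_one e).lt_or_eq with hlt1 | heq
        · have hodds0 := odds_of_a2_edge p h o c₀ c₁ hlt1 hodds
          have hrec := ih _ hlt (Function.update p e 0) hp0 hodds0 (by rw [liveRoot_update])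
          exact mul_nonneg (pow_nonneg hpe' 2) hrec
        · rw [heq]
          simp

/-- **The D-world `(ii)` of the roots-and-`b` class at every pair with `c₁ ≥ 0` satisfying the odds
condition at `p`.** -/
theorem iiExprD_nonneg_of_rootsAndB (p : E → R) (hp : IsProbVec p) {b : V}
    (he₀ : ends e₀ = s(b, a₃))
    (hroot : ∀ e, a₃ ∈ ends e → e ≠ e₀ → ends e = s(a₁, a₃) ∨ ends e = s(a₂, a₃)) (hb : b ≠ a₃)
    (h1 : a₁ ≠ a₃) (o : V) (c₀ c₁ : R) (hc₁ : 0 ≤ c₁)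
    (hodds : c₁ * prob p (connEvent ends a₁ a₃ ∩ connEvent ends a₂ o ∩ (connEvent ends a₁ a₂)ᶜ) ≤
      c₀ * prob p (connEvent ends a₁ a₃ ∩ (connEvent ends a₁ a₂)ᶜ)) :
    0 ≤ iiExprD p ends o a₁ a₂ a₃ b c₀ c₁ :=
  iiExprD_nonneg_of_rootsAnd_odds p hp hroot c₀ c₁ hc₁ hodds fun _ hp' hnull hodds' =>
    iiExprD_nonneg_of_leaf_supp_b hp' ⟨he₀, hnull, hb⟩ h1 o c₀ c₁ hodds'

/-- **`(ii-Q)` for `a₃` adjacent to the roots (any multiplicities) and to `b`** through `e₀`: the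
`(ii-Q)` entry of the roots-and-`b` row. -/
theorem zSplitIIQ_of_rootsAndB (p : E → R) (hp : IsProbVec p) {b : V} (he₀ : ends e₀ = s(b, a₃))
    (hroot : ∀ e, a₃ ∈ ends e → e ≠ e₀ → ends e = s(a₁, a₃) ∨ ends e = s(a₂, a₃)) (hb : b ≠ a₃)
    (h1 : a₁ ≠ a₃) (o : V) : ZSplitIIQ p ends o a₁ a₂ a₃ b := by
  unfold ZSplitIIQ
  exact iiExprT_nonneg_of_dworld p hp ends o a₁ a₂ a₃ b _ _
    (iiExprD_nonneg_of_rootsAndB p hp he₀ hroot hb h1 o _ _ (prob_nonneg hp _)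
      (odds_q p hp ends o a₁ a₂ a₃))
    (odds_q p hp ends o a₁ a₂ a₃)

end Induction

end CaseOne

end Summit.Ventures.PercRepro2
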